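import Mathlib
import Summits.NavierStokesRegularity.NavierStokesRegularity.Theorems.EulerZoomLiouvillePowerGaugeEulerLiouvilleCondenserCircleMeanCapacity
import Literature.Analysis.ODE.ConstCoeffL2Vanishing

/-!
# (C) THE CIRCULAR-MEAN CONDENSER CORE (nsreg-p2 g35 ROUND-45 «RAISING κ» §1, plate t47-C)

Width piece for crux `EulerZoomLiouville.PowerGaugeEulerLiouville` (stmt-NavierStokesRegularity-19832), by name under LEAD 19832
(ns-typeII-p2 g13); seat ns-ezl-w2 g4, `--supports stmt-NavierStokesRegularity-19832 --as helper`.  Text = nsreg-p2 g35's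
`r45/Sketch45.lean` Prop `NsregP2.R45.CircleMeanCondenserCore` binder-for-binder.  Plane calculus over `ℂ`, on ns-sfl-p1 g6's
circular-mean tools (p666609 `…CondenserCircleMeanCapacity`): it replaces the ray-by-ray core `Condenser.exp_le_gradient_or_small`
(constant `π/16`, sector dichotomy, short directions) by the MEAN capacity count with the full constant `2π`.

`ψ ∈ C¹(ℂ,ℝ)`, `ψ(0) ≥ m > 0`, `‖Dψ‖ ≤ G` on `|z| ≤ r`, `∫_{|z|≤r} ψ² ≤ A`, `∫_{|z|≤r} ‖Dψ‖² ≤ E`, `0 < δ < 1`.  Then EITHER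
`(1−δ)m ≤ √(2A/π)/r`, OR `G ≥ (δm/r)·exp(2π((1−δ)m − √(2A/π)/r)²/E)`:

* `two_pi_mul_sq_circleAverage_le` — Jensen on a circle: `2π·(⨍ψ)² ≤ ∫_0^{2π} ψ(circleMap 0 ρ θ)² dθ`, i.e. `(⨍ψ)² ≤ ⨍ψ²`;
* `exists_circleAverage_le_of_sq_budget` — OUTER CIRCLE: `∫_{|z|≤r} ψ² ≤ A`, `ψ(0) > 0` ⇒ some `r₁ ∈ [r/2, r]` has
  `⨍_{|z|=r₁} ψ ≤ √(2A/π)/r` (else `∫_{r/2≤|z|≤r} ψ² ≥ 2π∫_{r/2}^r ρ(⨍ψ)² > (3/2)A`);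
* `le_circleAverage_of_gradient_bound` — INNER CIRCLE: `‖Dψ‖ ≤ G` on `|z| ≤ r`, `0 ≤ w ≤ r` ⇒ `⨍_{|z|=w} ψ ≥ ψ(0) − Gw`;
* **`circleMeanCondenserCore_of`**, `circleMeanCondenserCore` — the dichotomy (capacity of the annulus `δm/G ≤ |z| ≤ r₁`,
  `Condenser.annulusEnergy_ge_circleAverage_amplitude`).

HONEST FRAMING: a lemma of real analysis in the plane; nothing here proves the crux E (19832 OPEN), any door Target, or any Navier–Stokes
statement; MODEL lattice only. [folklore (logarithmic capacity of an annulus); cite: ConstantinIgnatovaVicol2026Putative, §3.4.1 for the setting]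
-/

noncomputable section

open Set Filter Topology Metric Function MeasureTheory Real

set_option linter.dupNamespace false

namespace Summit.NavierStokesRegularity.NavierStokesRegularity.Theorems.PowerGaugeEulerLiouville.Condenser

/-! ## Jensen on a circle -/

/-- **Jensen on a circle**: `2π · (⨍_{|z|=ρ} ψ)² ≤ ∫_0^{2π} ψ(circleMap 0 ρ θ)² dθ` for continuous `ψ`. [folklore] -/
theorem two_pi_mul_sq_circleAverage_le {ψ : ℂ → ℝ} (hψ : Continuous ψ) (ρ : ℝ) :
    2 * π * Real.circleAverage ψ 0 ρ ^ 2 ≤ ∫ θ in (0 : ℝ)..2 * π, ψ (circleMap 0 ρ θ) ^ 2 := by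
  have h2π : (0 : ℝ) < 2 * π := two_pi_pos
  have hCS := Literature.Analysis.ODE.sq_intervalIntegral_le (hψ.comp (continuous_circleMap 0 ρ)) h2π.le
  rw [sub_zero] at hCS
  rw [Real.circleAverage_def, smul_eq_mul, mul_pow, inv_pow]
  have e : 2 * π * ((2 * π) ^ 2)⁻¹ * (∫ θ in (0 : ℝ)..2 * π, ψ (circleMap 0 ρ θ)) ^ 2 =
      (2 * π)⁻¹ * (∫ θ in (0 : ℝ)..2 * π, ψ (circleMap 0 ρ θ)) ^ 2 := by
    field_simp
  rw [← mul_assoc, e, inv_mul_le_iff₀ h2π]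
  exact hCS

/-- `(⨍ψ)² ≤ ⨍ψ²` on a circle. [folklore] -/
theorem sq_circleAverage_le_circleAverage_sq {ψ : ℂ → ℝ} (hψ : Continuous ψ) (ρ : ℝ) :
    Real.circleAverage ψ 0 ρ ^ 2 ≤ Real.circleAverage (fun z => ψ z ^ 2) 0 ρ := by
  have h2π : (0 : ℝ) < 2 * π := two_pi_pos
  have h := two_pi_mul_sq_circleAverage_le hψ ρ
  rw [Real.circleAverage_def (f := fun z => ψ z ^ 2), smul_eq_mul, ← div_eq_inv_mul]
  exact (le_div_iff₀' h2π).2 h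

/-! ## The outer circle (Chebyshev) -/

/-- **OUTER CIRCLE.**  `ψ` continuous, `0 < r`, `∫_{|z| ≤ r} ψ² ≤ A` and `ψ(0) ≠ 0`... more precisely `ψ` not a.e. zero on the ball is not
needed: if every circular mean on `[r/2, r]` exceeded `√(2A/π)/r`, Jensen and the polar formula would give `∫_{r/2≤|z|≤r} ψ² ≥ (3/2)A`,
and `A > 0` because `ψ² > 0` near `0`.  Hence some `r₁ ∈ [r/2, r]` has `⨍_{|z|=r₁} ψ ≤ √(2A/π)/r`. [folklore] -/
theorem exists_circleAverage_le_of_sq_budget {ψ : ℂ → ℝ} (hψ : Continuous ψ) {r A : ℝ} (hr : 0 < r) (hψ0 : 0 < ψ 0)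
    (hA : ∫ z in closedBall (0 : ℂ) r, ψ z ^ 2 ≤ A) :
    ∃ r₁ ∈ Icc (r / 2) r, Real.circleAverage ψ 0 r₁ ≤ Real.sqrt (2 * A / π) / r := by
  by_contra hcon
  push Not at hcon
  set B : ℝ := Real.sqrt (2 * A / π) / r with hB
  have hB0 : 0 ≤ B := div_nonneg (Real.sqrt_nonneg _) hr.le
  have hψ2c : Continuous fun z => ψ z ^ 2 := hψ.pow 2
  -- `A > 0`
  have hApos : 0 < A := by
    have hint : IntegrableOn (fun z => ψ z ^ 2) (closedBall (0 : ℂ) r) :=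
      hψ2c.continuousOn.integrableOn_compact (isCompact_closedBall 0 r)
    have hpos : 0 < ∫ z in closedBall (0 : ℂ) r, ψ z ^ 2 := by
      rw [integral_pos_iff_support_of_nonneg_ae (Eventually.of_forall fun z => sq_nonneg (ψ z)) hint,
        Measure.restrict_apply' measurableSet_closedBall]
      -- the support contains the open set `{ψ² > 0} ∩ ball 0 r ∋ 0`
      have hopen : IsOpen ({z : ℂ | 0 < ψ z ^ 2} ∩ ball (0 : ℂ) r) := (isOpen_lt continuous_const hψ2c).inter isOpen_ball
      have hne : ({z : ℂ | 0 < ψ z ^ 2} ∩ ball (0 : ℂ) r).Nonempty := ⟨0, by simpa using pow_pos hψ0 2, mem_ball_self hr⟩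
      refine (hopen.measure_pos volume hne).trans_le (measure_mono ?_)
      rintro z ⟨hz, hzr⟩
      exact ⟨Function.mem_support.2 (ne_of_gt hz), ball_subset_closedBall hzr⟩
    exact hpos.trans_le hA
  -- the annulus `r/2 ≤ |z| ≤ r`
  have hr2 : 0 < r / 2 := by linarith
  have hann := annulusIntegral_eq_integral_mul_circleAverage hψ2c hr2 (by linarith : r / 2 ≤ r)
  have hsub : {z : ℂ | r / 2 ≤ ‖z‖ ∧ ‖z‖ ≤ r} ⊆ closedBall (0 : ℂ) r := fun z hz => mem_closedBall_zero_iff.2 hz.2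
  have hmono : ∫ z in {z : ℂ | r / 2 ≤ ‖z‖ ∧ ‖z‖ ≤ r}, ψ z ^ 2 ≤ ∫ z in closedBall (0 : ℂ) r, ψ z ^ 2 :=
    setIntegral_mono_set (hψ2c.continuousOn.integrableOn_compact (isCompact_closedBall 0 r))
      (Eventually.of_forall fun z => sq_nonneg _) (Eventually.of_forall hsub)
  -- lower bound of the radial integral
  have hmc : Continuous fun ρ : ℝ => Real.circleAverage ψ 0 ρ := hψ.circleAverage
  have hm2c : Continuous fun ρ : ℝ => Real.circleAverage (fun z => ψ z ^ 2) 0 ρ := hψ2c.circleAverage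
  have hlow : ∫ ρ in (r / 2)..r, ρ * B ^ 2 ≤ ∫ ρ in (r / 2)..r, ρ * Real.circleAverage (fun z => ψ z ^ 2) 0 ρ := by
    refine intervalIntegral.integral_mono_on (by linarith) ((continuous_id.mul continuous_const).intervalIntegrable _ _)
      ((continuous_id.mul hm2c).intervalIntegrable _ _) fun ρ hρ => ?_
    have hρ0 : 0 ≤ ρ := hr2.le.trans hρ.1
    refine mul_le_mul_of_nonneg_left ?_ hρ0
    have h1 : B ^ 2 ≤ Real.circleAverage ψ 0 ρ ^ 2 := pow_le_pow_left₀ hB0 (hcon ρ hρ).le 2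
    exact h1.trans (sq_circleAverage_le_circleAverage_sq hψ ρ)
  have hconst : ∫ ρ in (r / 2)..r, ρ * B ^ 2 = 3 / 8 * r ^ 2 * B ^ 2 := by
    rw [intervalIntegral.integral_mul_const, integral_id]; ring
  have hB2 : r ^ 2 * B ^ 2 = 2 * A / π := by
    rw [hB, div_pow, Real.sq_sqrt (by positivity)]; field_simp
  -- assemble: `(3/2) A ≤ A`
  have h3 : 2 * π * (3 / 8 * r ^ 2 * B ^ 2) ≤ A := by
    calc 2 * π * (3 / 8 * r ^ 2 * B ^ 2) = 2 * π * ∫ ρ in (r / 2)..r, ρ * B ^ 2 := by rw [hconst]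
      _ ≤ 2 * π * ∫ ρ in (r / 2)..r, ρ * Real.circleAverage (fun z => ψ z ^ 2) 0 ρ :=
          mul_le_mul_of_nonneg_left hlow two_pi_pos.le
      _ = ∫ z in {z : ℂ | r / 2 ≤ ‖z‖ ∧ ‖z‖ ≤ r}, ψ z ^ 2 := hann.symm
      _ ≤ A := hmono.trans hA
  have h4 : 2 * π * (3 / 8 * r ^ 2 * B ^ 2) = 3 / 2 * A := by
    rw [mul_assoc (3 / 8 : ℝ), hB2]; field_simp; ring
  linarith

/-! ## The inner circle (mean value inequality) -/

/-- **INNER CIRCLE.**  `ψ ∈ C¹`, `‖Dψ‖ ≤ G` on `|z| ≤ r`, `0 ≤ w ≤ r`: `ψ(0) − G·w ≤ ⨍_{|z|=w} ψ`. [folklore] -/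
theorem le_circleAverage_of_gradient_bound {ψ : ℂ → ℝ} (hψ : ContDiff ℝ 1 ψ) {r G w : ℝ}
    (hG : ∀ z ∈ closedBall (0 : ℂ) r, ‖fderiv ℝ ψ z‖ ≤ G) (hw0 : 0 ≤ w) (hwr : w ≤ r) :
    ψ 0 - G * w ≤ Real.circleAverage ψ 0 w := by
  have hpt : ∀ z ∈ sphere (0 : ℂ) |w|, ψ 0 - G * w ≤ ψ z := by
    intro z hz
    rw [mem_sphere_zero_iff_norm, abs_of_nonneg hw0] at hz
    have hzball : z ∈ closedBall (0 : ℂ) r := mem_closedBall_zero_iff.2 (hz.le.trans hwr)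
    have hmvt := Convex.norm_image_sub_le_of_norm_fderiv_le (fun x _ => (hψ.differentiable one_ne_zero) x) hG
      (convex_closedBall (0 : ℂ) r) (mem_closedBall_self (hw0.trans hwr)) hzball
    rw [sub_zero, hz, Real.norm_eq_abs] at hmvt
    have := neg_abs_le (ψ z - ψ 0)
    linarith
  have h := Real.circleAverage_mono (circleIntegrable_const (ψ 0 - G * w) 0 w)
    ((hψ.continuous.continuousOn).circleIntegrable') hpt
  rwa [Real.circleAverage_const] at h

/-! ## The dichotomy -/

/-- **(C) THE CIRCULAR-MEAN CONDENSER CORE.**  See the module docstring. [folklore (logarithmic capacity of an annulus)] -/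
theorem circleMeanCondenserCore_of {ψ : ℂ → ℝ} {m G A E r δ : ℝ} (hψ : ContDiff ℝ 1 ψ) (hm : 0 < m) (hmψ : m ≤ ψ 0)
    (hr : 0 < r) (hδ : 0 < δ) (hE : 0 < E)
    (hG : ∀ z ∈ closedBall (0 : ℂ) r, ‖fderiv ℝ ψ z‖ ≤ G)
    (hA : ∫ z in closedBall (0 : ℂ) r, ψ z ^ 2 ≤ A)
    (hEn : ∫ z in closedBall (0 : ℂ) r, ‖fderiv ℝ ψ z‖ ^ 2 ≤ E) :
    (1 - δ) * m ≤ Real.sqrt (2 * A / π) / r ∨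
      δ * m / r * Real.exp (2 * π * ((1 - δ) * m - Real.sqrt (2 * A / π) / r) ^ 2 / E) ≤ G := by
  set B : ℝ := Real.sqrt (2 * A / π) / r with hB
  by_cases hfirst : (1 - δ) * m ≤ B
  · exact Or.inl hfirst
  right
  push Not at hfirst
  -- the outer circle
  obtain ⟨r₁, hr₁, hmean₁⟩ := exists_circleAverage_le_of_sq_budget hψ.continuous hr (hm.trans_le hmψ) hA
  -- `G > δ m / r₁ ≥ δ m / r`: otherwise the circle `r₁` has mean `> B`
  have hG0 : 0 ≤ G := (norm_nonneg _).trans (hG 0 (mem_closedBall_self hr.le))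
  have hr₁pos : 0 < r₁ := by linarith [hr₁.1]
  have hGr : δ * m < G * r₁ := by
    by_contra hle
    push Not at hle
    have h1 := le_circleAverage_of_gradient_bound hψ hG hr₁pos.le hr₁.2
    have h2 : (1 - δ) * m ≤ ψ 0 - G * r₁ := by nlinarith
    linarith
  have hGpos : 0 < G := by
    by_contra h; push Not at h
    have : G * r₁ ≤ 0 := mul_nonpos_of_nonpos_of_nonneg h hr₁pos.le
    nlinarith
  -- the inner circle `w₀ = δ m / G < r₁`
  set w₀ : ℝ := δ * m / G with hw₀
  have hw₀pos : 0 < w₀ := by rw [hw₀]; positivity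
  have hw₀r₁ : w₀ < r₁ := by rw [hw₀, div_lt_iff₀ hGpos]; linarith
  have hmean₀ : (1 - δ) * m ≤ Real.circleAverage ψ 0 w₀ := by
    have h1 := le_circleAverage_of_gradient_bound hψ hG hw₀pos.le (hw₀r₁.le.trans hr₁.2)
    have e : G * w₀ = δ * m := by rw [hw₀]; field_simp
    rw [e] at h1
    linarith
  -- capacity of the annulus `w₀ ≤ |z| ≤ r₁`
  have hcap := annulusEnergy_ge_circleAverage_amplitude hψ hw₀pos hw₀r₁
  have hsub : {z : ℂ | w₀ ≤ ‖z‖ ∧ ‖z‖ ≤ r₁} ⊆ closedBall (0 : ℂ) r := fun z hz =>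
    mem_closedBall_zero_iff.2 (hz.2.trans hr₁.2)
  have hEc : Continuous fun z => ‖fderiv ℝ ψ z‖ ^ 2 := ((hψ.continuous_fderiv one_ne_zero).norm).pow 2
  have hmono : ∫ z in {z : ℂ | w₀ ≤ ‖z‖ ∧ ‖z‖ ≤ r₁}, ‖fderiv ℝ ψ z‖ ^ 2 ≤ E :=
    (setIntegral_mono_set (hEc.continuousOn.integrableOn_compact (isCompact_closedBall 0 r))
      (Eventually.of_forall fun z => sq_nonneg _) (Eventually.of_forall hsub)).trans hEn
  have hlog : 0 < Real.log (r₁ / w₀) := Real.log_pos ((one_lt_div hw₀pos).2 hw₀r₁)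
  have hD : (1 - δ) * m - B ≤ Real.circleAverage ψ 0 w₀ - Real.circleAverage ψ 0 r₁ := by linarith
  have hD0 : 0 ≤ (1 - δ) * m - B := by linarith
  -- `2π((1−δ)m − B)² ≤ E · log(r₁/w₀) ≤ E · log(r/w₀)`
  have h1 : 2 * π * ((1 - δ) * m - B) ^ 2 ≤ E * Real.log (r₁ / w₀) := by
    have h2 : 2 * π * ((1 - δ) * m - B) ^ 2 ≤
        2 * π * (Real.circleAverage ψ 0 w₀ - Real.circleAverage ψ 0 r₁) ^ 2 :=
      mul_le_mul_of_nonneg_left (pow_le_pow_left₀ hD0 hD 2) two_pi_pos.le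
    have h3 := (div_le_iff₀ hlog).1 (hcap.trans hmono)
    linarith
  have hlogmono : Real.log (r₁ / w₀) ≤ Real.log (r / w₀) :=
    Real.log_le_log (div_pos hr₁pos hw₀pos) (div_le_div_of_nonneg_right hr₁.2 hw₀pos.le)
  have h4 : 2 * π * ((1 - δ) * m - B) ^ 2 / E ≤ Real.log (r / w₀) := by
    rw [div_le_iff₀ hE]
    calc 2 * π * ((1 - δ) * m - B) ^ 2 ≤ E * Real.log (r₁ / w₀) := h1
      _ ≤ E * Real.log (r / w₀) := mul_le_mul_of_nonneg_left hlogmono hE.le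
      _ = Real.log (r / w₀) * E := mul_comm _ _
  have h5 : Real.exp (2 * π * ((1 - δ) * m - B) ^ 2 / E) ≤ r / w₀ := by
    rw [← Real.exp_log (div_pos hr hw₀pos)]
    exact Real.exp_le_exp.2 h4
  have e : r / w₀ = r * G / (δ * m) := by rw [hw₀]; field_simp
  rw [e, le_div_iff₀ (by positivity)] at h5
  rw [div_mul_eq_mul_div, div_le_iff₀ hr]
  nlinarith [h5]

/-- **`NsregP2.R45.CircleMeanCondenserCore`, binder-for-binder** (Sketch45 of nsreg-p2 g35, plate t47-C).
[folklore (logarithmic capacity of an annulus)] -/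
theorem circleMeanCondenserCore :
    ∀ (ψ : ℂ → ℝ) (m G A E r δ : ℝ), ContDiff ℝ 1 ψ → 0 < m → m ≤ ψ 0 → 0 < r → 0 < δ → δ < 1 → 0 < E →
      (∀ z ∈ closedBall (0 : ℂ) r, ‖fderiv ℝ ψ z‖ ≤ G) →
      (∫ z in closedBall (0 : ℂ) r, ψ z ^ 2 ≤ A) →
      (∫ z in closedBall (0 : ℂ) r, ‖fderiv ℝ ψ z‖ ^ 2 ≤ E) →
      (1 - δ) * m ≤ Real.sqrt (2 * A / Real.pi) / r ∨
        δ * m / r * Real.exp (2 * Real.pi * ((1 - δ) * m - Real.sqrt (2 * A / Real.pi) / r) ^ 2 / E) ≤ G :=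
  fun _ _ _ _ _ _ _ hψ hm hmψ hr hδ _ hE hG hA hEn => circleMeanCondenserCore_of hψ hm hmψ hr hδ hE hG hA hEn

end Summit.NavierStokesRegularity.NavierStokesRegularity.Theorems.PowerGaugeEulerLiouville.Condenser

end
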